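import Summits.BirchSwinnertonDyer.Rank1Residual.GaloisImage.SakamotoN11InstanceDeep
import Summits.BirchSwinnertonDyer.Rank1Residual.GaloisImage.SakamotoN11InstanceWeil
import Summits.BirchSwinnertonDyer.Rank1Residual.GaloisImage.SakamotoN11InstanceLevelOneLocal
import Summits.BirchSwinnertonDyer.Rank1Residual.GaloisImage.KolyvaginLedgerAlgebra
import Summits.BirchSwinnertonDyer.Rank1Residual.GaloisImage.UnramifiedOrthogonalOfIsPerfect
import Summits.BirchSwinnertonDyer.Rank1Residual.GaloisImage.ExoticNoHigherLevelTau
import HarnessLib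

/-!
# The N11 instance of Sakamoto 2024 Thm. 4.4 (1)(2) on the DEEP Frobenius sub-class UNDER THE
# `3`-ADIC TOWER, every dischargeable hypothesis discharged, and the generator unpacked
# (cell `b2b-bsdres`, team n1011, seat p15 GEN 3, OWNERS row T-S24D = route planner 1's R1-47 (a),
# `cells/n1011/ROUTE-1.md` §27.6 / §28.4; file 3 of the row, sequel of `SakamotoN11InstanceDeep.lean`)

HONEST FRAMING (cell `b2b-bsdres`, run/shared/lean/b2b/bsd-rank1-residual/, verbatim in every
file): the goal of the cell is to DELETE the COMBINATION-SHAPED residual classes of the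
Birch–Swinnerton-Dyer formula for ALL analytic-rank `≤ 1` elliptic curves over `ℚ` — "full BSD
formula for every rank `≤ 1` curve in class `C`" assembled STRICTLY from published theorems — so
that the rank-`≤ 1` remainder becomes exactly the CONSTRUCTION-SHAPED classes, which are TYPED
(missing-input `Prop`s), NOT attempted. This is not "finishing BSD". Team n1011 (N10 / N11, the
additive block X4 ∧ `p = 3`): research route on the CONSTRUCTION-SHAPED class X4; no claim beyond
the stated classes; nothing is booked; no label and no RESIDUAL-MAP mark is moved. Theorems only (no
definition, no named fact, no `sorry`); CONDITIONAL on the S24-DEEP PORT (cc-typer-1,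
`KolyvaginDeepSubclass.lean`, p268594, flag `S24-DEEP-PORT@3`) taken as the hypotheses `hS24d` /
`hS24d₂`, exactly as n1011-p13's pinned instances are conditional on `hS24` / `hS24₂`.

## What and why

File 2 of the row (`SakamotoN11InstanceDeep.lean`) re-ran p13's N11 instances of [S24] Thm. 4.4 (1)(2)
on the DEEP class `𝒫′ = frobeniusClassPrimes (E[3^{k′+1}]) S τ 3^{k′+1}` (module `E[3^{k+1}]`,
`k ≤ k′`) in p13's binder shape.  Here, under the `3`-adic tower and for `S ⊇ ∞ ∪ {3} ∪ {bad}`, every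
hypothesis that is a theorem of the tree is DISCHARGED — (H.3′) by n1011-p04's `hH3_three_of_towerSurj W k′`
(LITERALLY the port's (Δ3)), (H.SD) and the residual coisotropy by the Weil pairing (n1011-p18's
pattern), `hS′`/`hS″`/`hunr` by n1011-p05's `not_mem_and_isUnramifiedAt_of_not_mem` /
`propagatedSelmerStructure_isUnramifiedOutside`, the CORE RANK by n1011-p04's
`hasCoreRank_one_propagatedSelmerStructureOne_of_isPerfect_of_localEuler` (row T-Lp), and the unramified
orthogonality of both Poitou–Tate families by n1011-p04's `UnramifiedCup.unramifiedOrthogonal_of_isPerfect`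
(row T-UO-K; so the families enter with p271924's THREE properties) — and conclusion
(1) is unpacked into ONE Kolyvagin system `κ` that is simultaneously p271924's `(g′, hg′, hgo′, hgen′)`
and the `zmultiples`-basis of (2) (`hR22′`), as route planner 1 prescribes (§27.2: "take `g := κ.1`
for the SAME `κ` that feeds `hR22`").  Binders left at one depth (nothing hidden): the two ports,
`k ≤ k′`, the tower, ONE τ-datum at the deepest level (`hτμ` at `3^{k′+1}`, `hτq′` on `E[3^{k′+1}]`;
both hold for the tower's `σ`, and for the Frobenius of any flagged Kolyvagin prime at that level by
n1011-p18's `FrobShape.exists_frobenius_shape'`; the module-level (H.2) is derived by n1011-p13's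
`nonempty_cokerSubOne_equiv_zmod_pow_of_le`, route planner 1 §29.3 (3)),
the Poitou–Tate family `inv` ×3 at `3` (+ `inv′` ×3 at `3^{k+1}` inside (2)), Tate's `hEP` at every
finite place, `S` (`hS`, `h3S`, `hbadS`), and the datum (`D`, `η`, `hP`, `hT`, `hD`), which EXISTS by
file 1 (`S24Deep.exists_eta_kolyvaginDatum_torsion_pow_mul_deep`).

References: R. Sakamoto, JTNB **36** (2024) §2, Def. 3.5–3.8, Def. 4.2, Thm. 4.4 (pp. 920–926)
[Sakamoto2024]; B. Mazur, K. Rubin, Mem. AMS **799** (2004) §3.5 (H.5), Cor. 4.5.2 (iv), Prop. A.2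
[MazurRubin2004]; J. S. Milne, *ADT* I Thm. 2.8 [MilneADT2006].
-/

noncomputable section

open scoped Classical NumberField ContRepresentation
open Field NumberField IsDedekindDomain
open WeierstrassCurve Literature.NumberTheory.EllipticCurves Literature.NumberTheory.GaloisRepresentations
  Literature.NumberTheory.GaloisRepresentations.DiscreteGaloisModule Literature.NumberTheory.GaloisCohomology

namespace Summit.BirchSwinnertonDyer.Rank1Residual.GaloisImage

variable (W : WeierstrassCurve ℚ) [W.IsElliptic]

/-! ### Under the `3`-adic tower with `S ⊇ ∞ ∪ {3} ∪ {bad}`: (H.3′), (H.SD), coisotropy, `hS′`/`hS″`/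
### `hunr` and the core rank DISCHARGED -/

section TowerSurj

/-- **S24-DEEP (1) on the deep class under the `3`-adic tower, `S ⊇ ∞ ∪ {3} ∪ {bad}`** — (H.3′) by
n1011-p04's `hH3_three_of_towerSurj W k′` (LITERALLY the port's (Δ3)), (H.SD) + coisotropy by the Weil
pairing (n1011-p18), `hS′`/`hS″`/`hunr` by n1011-p05, the CORE RANK by n1011-p04's
`hasCoreRank_one_propagatedSelmerStructureOne_of_isPerfect_of_localEuler` (T-Lp), and the
unramified orthogonality of the Poitou–Tate family by n1011-p04's
`UnramifiedCup.unramifiedOrthogonal_of_isPerfect` (T-UO-K, Milne I 2.6).  Binders left: the port,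
`k ≤ k′`, the tower, ONE τ-datum at the DEEPEST level (`hτμ` at `3^{k′+1}`, `hτq′` on `E[3^{k′+1}]`;
the module-level (H.2) is DERIVED by n1011-p13's `nonempty_cokerSubOne_equiv_zmod_pow_of_le` — route
planner 1 §29.3 (3)), `inv` ×3 (`IsPerfect`,
`SumLocalTermEqZero`, `SelmerComplement` — p271924's spelling), Tate's `hEP` at every finite place,
`S` (`hS`, `h3S`, `hbadS`), the datum (`D`, `η`, `hP`, `hT`, `hD`).
[cite: Sakamoto2024, §2 (H.3) (p. 921), Def. 3.6–3.8 (pp. 923–924), Thm. 4.4 (1) (p. 926)]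
[cite: MilneADT2006, Ch. I, Thm. 2.8] -/
theorem kolyvaginSystems_freeRankOne_propagatedSelmerStructure_deep_of_towerSurj
    (hS24d : S24Deep.kolyvaginSystems_freeRankOne_zmod_three_pow_deep) {k k' : ℕ} (hkk' : k ≤ k')
    [Finite (geomTorsion W ((3 : ℕ) : ℤ))] [Finite (geomTorsion W (((3 : ℕ) : ℤ) ^ k * ((3 : ℕ) : ℤ)))]
    [Finite (geomTorsion W (((3 : ℕ) : ℤ) ^ k' * ((3 : ℕ) : ℤ)))]
    (htower : ∀ n : ℕ, W.HasSurjectiveModNGaloisRep (3 ^ n : ℕ))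
    (τ : absoluteGaloisGroup ℚ) (hτμ : τ ∈ rootsOfUnityFixer ℚ (3 ^ (k' + 1)))
    (hτq' : Nonempty (cokerSubOne (W.torsionGaloisModule (((3 : ℕ) : ℤ) ^ k' * ((3 : ℕ) : ℤ))) τ ≃+
      ZMod (3 ^ (k' + 1))))
    (inv : LocalInvariants ℚ 3) (hperf : inv.IsPerfect) (hsum : inv.SumLocalTermEqZero)
    (hcompl : inv.SelmerComplement)
    (hEP : ∀ v : HeightOneSpectrum (𝓞 ℚ), localEulerPoincareCharacteristic (v.adicCompletion ℚ))
    (S : Finset (Place ℚ)) (hS : ∀ w : InfinitePlace ℚ, (Sum.inl w : Place ℚ) ∈ S)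
    (h3S : ∀ v : HeightOneSpectrum (𝓞 ℚ), ((3 : ℕ) : 𝓞 ℚ) ∈ v.asIdeal → (Sum.inr v : Place ℚ) ∈ S)
    (hbadS : ∀ v : HeightOneSpectrum (𝓞 ℚ), ¬ W.HasGoodReductionAt v → (Sum.inr v : Place ℚ) ∈ S)
    (D : KolyvaginDatum (W.torsionGaloisModule (((3 : ℕ) : ℤ) ^ k * ((3 : ℕ) : ℤ))))
    (η : (q : HeightOneSpectrum (𝓞 ℚ)) → (ZMod (Ideal.absNorm q.asIdeal))ˣ)
    (hP : D.primes = frobeniusClassPrimes (W.torsionGaloisModule (((3 : ℕ) : ℤ) ^ k' * ((3 : ℕ) : ℤ)))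
      {v | (Sum.inr v : Place ℚ) ∈ S} τ (3 ^ (k' + 1)))
    (hT : D.transverse = cyclotomicTransverse (W.torsionGaloisModule (((3 : ℕ) : ℤ) ^ k * ((3 : ℕ) : ℤ))))
    (hD : D.HasCanonicalComparison (3 ^ (k + 1)) η) :
    KolyvaginSystem.IsFreeRankOneZMod (D.kolyvaginSystems (propagatedSelmerStructure W 3 k))
        (3 ^ (k + 1)) ∧
      ∀ (d : Finset (HeightOneSpectrum (𝓞 ℚ))) (hd : D.IsLevel d),
        LocalInvariants.lambdaStar inv ((D.atLevel (propagatedSelmerStructure W 3 k) d).induced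
          (W.torsionMulBy (((3 : ℕ) : ℤ) ^ k) ((3 : ℕ) : ℤ))) 3 = 0 →
        Function.Bijective fun κ : D.kolyvaginSystems (propagatedSelmerStructure W 3 k) =>
          (⟨κ.1 d, ((KolyvaginDatum.mem_kolyvaginSystems_iff D _ κ.1).mp κ.2).mem_selmerGroup
              d hd⟩ : (D.atLevel (propagatedSelmerStructure W 3 k) d).selmerGroup) := by
  haveI : Fact (Nat.Prime 3) := ⟨Nat.prime_three⟩
  have hτq : Nonempty (cokerSubOne (W.torsionGaloisModule (((3 : ℕ) : ℤ) ^ k * ((3 : ℕ) : ℤ))) τ ≃+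
      ZMod (3 ^ (k + 1))) := by
    have hle : k + 1 ≤ k' + 1 := Nat.succ_le_succ hkk'
    have hl' : ((3 : ℕ) : ℤ) ^ (k' + 1) = ((3 : ℕ) : ℤ) ^ k' * ((3 : ℕ) : ℤ) := pow_succ _ _
    have hl : ((3 : ℕ) : ℤ) ^ (k + 1) = ((3 : ℕ) : ℤ) ^ k * ((3 : ℕ) : ℤ) := pow_succ _ _
    have h1 : Nonempty (cokerSubOne (W.torsionGaloisModule (((3 : ℕ) : ℤ) ^ (k' + 1))) τ ≃+
        ZMod (3 ^ (k' + 1))) := by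
      rw [hl']; exact hτq'
    have h := nonempty_cokerSubOne_equiv_zmod_pow_of_le W Nat.prime_three hle τ h1
    rw [hl] at h
    exact h
  have hunro : inv.UnramifiedOrthogonal :=
    UnramifiedCup.unramifiedOrthogonal_of_isPerfect inv Nat.prime_three.isPrimePow hperf
  have h3T : ∀ v : HeightOneSpectrum (𝓞 ℚ), ((3 : ℕ) : 𝓞 ℚ) ∈ v.asIdeal →
      v ∈ S.preimage Sum.inr Sum.inr_injective.injOn := fun v hv => Finset.mem_preimage.mpr (h3S v hv)
  have hbadT : ∀ v : HeightOneSpectrum (𝓞 ℚ), ¬ W.HasGoodReductionAt v →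
      v ∈ S.preimage Sum.inr Sum.inr_injective.injOn := fun v hv => Finset.mem_preimage.mpr (hbadS v hv)
  obtain ⟨e, hμ, hadd₁, hadd₂, halt, hnondeg, hgal⟩ :=
    exists_weilPairing_holds W 3 (by norm_num) (by norm_num)
  exact kolyvaginSystems_freeRankOne_propagatedSelmerStructure_deep W hS24d hkk'
    (by simpa using htower 1) τ hτμ hτq (hH3_three_of_towerSurj W k' htower)
    (weilDualIntertwining W 3 e hμ hadd₁ hadd₂ hgal)
    (X11b.LocBridge.weilDualHom_bijective W 3 e hμ hadd₁ hadd₂ hnondeg)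
    inv hperf hsum hunro hcompl S hS
    (fun v hv => (not_mem_and_isUnramifiedAt_of_not_mem W 3 k' S h3S hbadS hv).1)
    (fun v hv => (not_mem_and_isUnramifiedAt_of_not_mem W 3 k' S h3S hbadS hv).2)
    (propagatedSelmerStructure_isUnramifiedOutside W 3 k S hS h3S hbadS)
    (hasCoreRank_one_propagatedSelmerStructureOne_of_isPerfect_of_localEuler W inv hperf hsum hcompl
      hEP _ h3T hbadT)
    (isResiduallyCoisotropic_propagatedSelmerStructureOne_three W e hμ hadd₁ hadd₂ hgal halt hnondeg
      inv hperf S fun v _ => hEP v)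
    D η hP hT hD

/-- **S24-DEEP (2), ORDER form, on the deep class under the `3`-adic tower, `S ⊇ ∞ ∪ {3} ∪ {bad}`** —
same discharges as (1) (unramified orthogonality of BOTH families by T-UO-K); binders left: the port
`hS24d₂`, `k ≤ k′`, the tower, the deepest τ-datum (`hτμ`, `hτq′` at `3^{k′+1}`), `inv` ×3, `hEP`,
`S` (`hS`, `h3S`, `hbadS`), the datum, the
full-level family `inv′` ×3 (p271924's spelling), the basis `κ` (`hκ`), the level `d` (`hd`).  This is
p271924's `hR22′ k′ d hd` for `g′ k′ := κ.1`.
[cite: Sakamoto2024, §2 (H.3) (p. 921), Def. 4.2 and Thm. 4.4 (2) (p. 926)] [cite: MilneADT2006, Ch. I, Thm. 2.8] -/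
theorem kolyvaginSystems_idealOfBasis_propagatedSelmerStructure_deep_of_towerSurj
    (hS24d₂ : S24Deep.kolyvaginSystems_idealOfBasis_eq_fittingIdeal_zmod_three_pow_deep)
    {k k' : ℕ} (hkk' : k ≤ k')
    [Finite (geomTorsion W ((3 : ℕ) : ℤ))] [Finite (geomTorsion W (((3 : ℕ) : ℤ) ^ k * ((3 : ℕ) : ℤ)))]
    [Finite (geomTorsion W (((3 : ℕ) : ℤ) ^ k' * ((3 : ℕ) : ℤ)))]
    (htower : ∀ n : ℕ, W.HasSurjectiveModNGaloisRep (3 ^ n : ℕ))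
    (τ : absoluteGaloisGroup ℚ) (hτμ : τ ∈ rootsOfUnityFixer ℚ (3 ^ (k' + 1)))
    (hτq' : Nonempty (cokerSubOne (W.torsionGaloisModule (((3 : ℕ) : ℤ) ^ k' * ((3 : ℕ) : ℤ))) τ ≃+
      ZMod (3 ^ (k' + 1))))
    (inv : LocalInvariants ℚ 3) (hperf : inv.IsPerfect) (hsum : inv.SumLocalTermEqZero)
    (hcompl : inv.SelmerComplement)
    (hEP : ∀ v : HeightOneSpectrum (𝓞 ℚ), localEulerPoincareCharacteristic (v.adicCompletion ℚ))
    (S : Finset (Place ℚ)) (hS : ∀ w : InfinitePlace ℚ, (Sum.inl w : Place ℚ) ∈ S)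
    (h3S : ∀ v : HeightOneSpectrum (𝓞 ℚ), ((3 : ℕ) : 𝓞 ℚ) ∈ v.asIdeal → (Sum.inr v : Place ℚ) ∈ S)
    (hbadS : ∀ v : HeightOneSpectrum (𝓞 ℚ), ¬ W.HasGoodReductionAt v → (Sum.inr v : Place ℚ) ∈ S)
    (D : KolyvaginDatum (W.torsionGaloisModule (((3 : ℕ) : ℤ) ^ k * ((3 : ℕ) : ℤ))))
    (η : (q : HeightOneSpectrum (𝓞 ℚ)) → (ZMod (Ideal.absNorm q.asIdeal))ˣ)
    (hP : D.primes = frobeniusClassPrimes (W.torsionGaloisModule (((3 : ℕ) : ℤ) ^ k' * ((3 : ℕ) : ℤ)))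
      {v | (Sum.inr v : Place ℚ) ∈ S} τ (3 ^ (k' + 1)))
    (hT : D.transverse = cyclotomicTransverse (W.torsionGaloisModule (((3 : ℕ) : ℤ) ^ k * ((3 : ℕ) : ℤ))))
    (hD : D.HasCanonicalComparison (3 ^ (k + 1)) η)
    (inv' : LocalInvariants ℚ (3 ^ (k + 1))) (hperf' : inv'.IsPerfect)
    (hsum' : inv'.SumLocalTermEqZero) (hcompl' : inv'.SelmerComplement)
    (κ : D.kolyvaginSystems (propagatedSelmerStructure W 3 k)) (hκ : AddSubgroup.zmultiples κ = ⊤)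
    (d : Finset (HeightOneSpectrum (𝓞 ℚ))) (hd : D.IsLevel d) :
    (Nat.card (inv'.dualSelmerStructure (W.torsionGaloisModule (((3 : ℕ) : ℤ) ^ k * ((3 : ℕ) : ℤ)))
        (D.atLevel (propagatedSelmerStructure W 3 k) d)).selmerGroup ∣ 3 ^ (k + 1) →
      addOrderOf (κ.1 d) *
        Nat.card (inv'.dualSelmerStructure (W.torsionGaloisModule (((3 : ℕ) : ℤ) ^ k * ((3 : ℕ) : ℤ)))
          (D.atLevel (propagatedSelmerStructure W 3 k) d)).selmerGroup = 3 ^ (k + 1)) ∧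
    (3 ^ (k + 1) ∣ Nat.card (inv'.dualSelmerStructure
        (W.torsionGaloisModule (((3 : ℕ) : ℤ) ^ k * ((3 : ℕ) : ℤ)))
          (D.atLevel (propagatedSelmerStructure W 3 k) d)).selmerGroup → κ.1 d = 0) := by
  haveI : Fact (Nat.Prime 3) := ⟨Nat.prime_three⟩
  have hτq : Nonempty (cokerSubOne (W.torsionGaloisModule (((3 : ℕ) : ℤ) ^ k * ((3 : ℕ) : ℤ))) τ ≃+
      ZMod (3 ^ (k + 1))) := by
    have hle : k + 1 ≤ k' + 1 := Nat.succ_le_succ hkk'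
    have hl' : ((3 : ℕ) : ℤ) ^ (k' + 1) = ((3 : ℕ) : ℤ) ^ k' * ((3 : ℕ) : ℤ) := pow_succ _ _
    have hl : ((3 : ℕ) : ℤ) ^ (k + 1) = ((3 : ℕ) : ℤ) ^ k * ((3 : ℕ) : ℤ) := pow_succ _ _
    have h1 : Nonempty (cokerSubOne (W.torsionGaloisModule (((3 : ℕ) : ℤ) ^ (k' + 1))) τ ≃+
        ZMod (3 ^ (k' + 1))) := by
      rw [hl']; exact hτq'
    have h := nonempty_cokerSubOne_equiv_zmod_pow_of_le W Nat.prime_three hle τ h1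
    rw [hl] at h
    exact h
  have hunro : inv.UnramifiedOrthogonal :=
    UnramifiedCup.unramifiedOrthogonal_of_isPerfect inv Nat.prime_three.isPrimePow hperf
  have hunro' : inv'.UnramifiedOrthogonal :=
    UnramifiedCup.unramifiedOrthogonal_of_isPerfect inv'
      (Nat.prime_three.isPrimePow.pow (Nat.succ_ne_zero k)) hperf'
  have h3T : ∀ v : HeightOneSpectrum (𝓞 ℚ), ((3 : ℕ) : 𝓞 ℚ) ∈ v.asIdeal →
      v ∈ S.preimage Sum.inr Sum.inr_injective.injOn := fun v hv => Finset.mem_preimage.mpr (h3S v hv)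
  have hbadT : ∀ v : HeightOneSpectrum (𝓞 ℚ), ¬ W.HasGoodReductionAt v →
      v ∈ S.preimage Sum.inr Sum.inr_injective.injOn := fun v hv => Finset.mem_preimage.mpr (hbadS v hv)
  obtain ⟨e, hμ, hadd₁, hadd₂, halt, hnondeg, hgal⟩ :=
    exists_weilPairing_holds W 3 (by norm_num) (by norm_num)
  exact kolyvaginSystems_idealOfBasis_propagatedSelmerStructure_deep W hS24d₂ hkk'
    (by simpa using htower 1) τ hτμ hτq (hH3_three_of_towerSurj W k' htower)
    (weilDualIntertwining W 3 e hμ hadd₁ hadd₂ hgal)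
    (X11b.LocBridge.weilDualHom_bijective W 3 e hμ hadd₁ hadd₂ hnondeg)
    inv hperf hsum hunro hcompl S hS
    (fun v hv => (not_mem_and_isUnramifiedAt_of_not_mem W 3 k' S h3S hbadS hv).1)
    (fun v hv => (not_mem_and_isUnramifiedAt_of_not_mem W 3 k' S h3S hbadS hv).2)
    (propagatedSelmerStructure_isUnramifiedOutside W 3 k S hS h3S hbadS)
    (hasCoreRank_one_propagatedSelmerStructureOne_of_isPerfect_of_localEuler W inv hperf hsum hcompl
      hEP _ h3T hbadT)
    (isResiduallyCoisotropic_propagatedSelmerStructureOne_three W e hμ hadd₁ hadd₂ hgal halt hnondeg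
      inv hperf S fun v _ => hEP v)
    D η hP hT hD inv' hperf' hsum' hunro' hcompl' κ hκ d hd

/-! ### Unpacking (1): ONE generator `κ` carrying `hg′`, `hgo′`, `hgen′` AND the `zmultiples`-basis
### property that (2) consumes -/

/-- **A `zmultiples`-basis with its order and ℕ-generation, from "free of rank one over `ℤ/N`"** (pure
algebra; the tree's `Ledger.exists_mem_generator_of_isFreeRankOneZMod` repackaged so that ONE element
serves both [S24] (1) — as p271924's `(g′, hg′, hgo′, hgen′)` — and [S24] (2) — as its basis `κ` with
`zmultiples κ = ⊤`). [cite: Sakamoto2024, Thm. 4.4 (1) (p. 926)] -/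
theorem exists_basis_of_isFreeRankOneZMod {Y : Type*} [AddCommGroup Y] (H : AddSubgroup Y)
    {N : ℕ} [NeZero N] (h : KolyvaginSystem.IsFreeRankOneZMod H N) :
    ∃ κ : H, AddSubgroup.zmultiples κ = ⊤ ∧ addOrderOf (κ : Y) = N ∧
      ∀ x ∈ H, ∃ a : ℕ, x = a • (κ : Y) := by
  obtain ⟨g, hg, hgo, hgen⟩ := Ledger.exists_mem_generator_of_isFreeRankOneZMod H h
  refine ⟨⟨g, hg⟩, (AddSubgroup.eq_top_iff' _).mpr fun x => ?_, hgo, fun x hx => ?_⟩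
  · obtain ⟨a, -, ha⟩ := hgen x.1 x.2
    exact AddSubgroup.mem_zmultiples_iff.mpr ⟨a, Subtype.ext (by
      rw [AddSubgroupClass.coe_zsmul, natCast_zsmul]; exact ha.symm)⟩
  · obtain ⟨a, -, ha⟩ := hgen x hx
    exact ⟨a, ha⟩

/-- **p271924's deep [S24] inputs at ONE depth, from the port under the tower**: for `k ≤ k′` and a
Kolyvagin datum of `E[3^{k+1}]` on the deep class through `E[3^{k′+1}]` (with `S ⊇ ∞ ∪ {3} ∪ {bad}`,
cyclotomic transverse conditions, canonical comparison), there is ONE Kolyvagin system `κ` which is a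
`zmultiples`-basis of `KS₁(E[3^{k+1}], 𝓕_can, 𝒫′)`, has additive order `3^{k+1}`, ℕ-generates `KS₁`
(`hg′`, `hgo′`, `hgen′`), AND satisfies Thm. 4.4 (2) in ORDER form at every level of the datum for
every full-level Poitou–Tate family `inv′` (`hR22′`).  CONDITIONAL on both ports.
[cite: Sakamoto2024, Thm. 4.4 (1)(2) (p. 926)] [cite: MazurRubin2004, §3.5 (H.5) (p. 27) and Prop. A.2 (pp. 79–80)] -/
theorem exists_generator_kolyvaginSystems_deep_of_towerSurj
    (hS24d : S24Deep.kolyvaginSystems_freeRankOne_zmod_three_pow_deep)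
    (hS24d₂ : S24Deep.kolyvaginSystems_idealOfBasis_eq_fittingIdeal_zmod_three_pow_deep)
    {k k' : ℕ} (hkk' : k ≤ k')
    [Finite (geomTorsion W ((3 : ℕ) : ℤ))] [Finite (geomTorsion W (((3 : ℕ) : ℤ) ^ k * ((3 : ℕ) : ℤ)))]
    [Finite (geomTorsion W (((3 : ℕ) : ℤ) ^ k' * ((3 : ℕ) : ℤ)))]
    (htower : ∀ n : ℕ, W.HasSurjectiveModNGaloisRep (3 ^ n : ℕ))
    (τ : absoluteGaloisGroup ℚ) (hτμ : τ ∈ rootsOfUnityFixer ℚ (3 ^ (k' + 1)))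
    (hτq' : Nonempty (cokerSubOne (W.torsionGaloisModule (((3 : ℕ) : ℤ) ^ k' * ((3 : ℕ) : ℤ))) τ ≃+
      ZMod (3 ^ (k' + 1))))
    (inv : LocalInvariants ℚ 3) (hperf : inv.IsPerfect) (hsum : inv.SumLocalTermEqZero)
    (hcompl : inv.SelmerComplement)
    (hEP : ∀ v : HeightOneSpectrum (𝓞 ℚ), localEulerPoincareCharacteristic (v.adicCompletion ℚ))
    (S : Finset (Place ℚ)) (hS : ∀ w : InfinitePlace ℚ, (Sum.inl w : Place ℚ) ∈ S)
    (h3S : ∀ v : HeightOneSpectrum (𝓞 ℚ), ((3 : ℕ) : 𝓞 ℚ) ∈ v.asIdeal → (Sum.inr v : Place ℚ) ∈ S)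
    (hbadS : ∀ v : HeightOneSpectrum (𝓞 ℚ), ¬ W.HasGoodReductionAt v → (Sum.inr v : Place ℚ) ∈ S)
    (D : KolyvaginDatum (W.torsionGaloisModule (((3 : ℕ) : ℤ) ^ k * ((3 : ℕ) : ℤ))))
    (η : (q : HeightOneSpectrum (𝓞 ℚ)) → (ZMod (Ideal.absNorm q.asIdeal))ˣ)
    (hP : D.primes = frobeniusClassPrimes (W.torsionGaloisModule (((3 : ℕ) : ℤ) ^ k' * ((3 : ℕ) : ℤ)))
      {v | (Sum.inr v : Place ℚ) ∈ S} τ (3 ^ (k' + 1)))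
    (hT : D.transverse = cyclotomicTransverse (W.torsionGaloisModule (((3 : ℕ) : ℤ) ^ k * ((3 : ℕ) : ℤ))))
    (hD : D.HasCanonicalComparison (3 ^ (k + 1)) η) :
    ∃ κ : D.kolyvaginSystems (propagatedSelmerStructure W 3 k),
      AddSubgroup.zmultiples κ = ⊤ ∧
      addOrderOf (κ.1 : Finset (HeightOneSpectrum (𝓞 ℚ)) →
        galoisCohomology (W.torsionGaloisModule (((3 : ℕ) : ℤ) ^ k * ((3 : ℕ) : ℤ))) 1) = 3 ^ (k + 1) ∧
      (∀ κ' ∈ D.kolyvaginSystems (propagatedSelmerStructure W 3 k), ∃ a : ℕ, κ' = a • κ.1) ∧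
      ∀ (inv' : LocalInvariants ℚ (3 ^ (k + 1))), inv'.IsPerfect → inv'.SumLocalTermEqZero →
        inv'.SelmerComplement →
        ∀ d, D.IsLevel d →
          (Nat.card (inv'.dualSelmerStructure _
              (D.atLevel (propagatedSelmerStructure W 3 k) d)).selmerGroup ∣ 3 ^ (k + 1) →
            addOrderOf (κ.1 d) * Nat.card (inv'.dualSelmerStructure _
              (D.atLevel (propagatedSelmerStructure W 3 k) d)).selmerGroup = 3 ^ (k + 1)) ∧
          (3 ^ (k + 1) ∣ Nat.card (inv'.dualSelmerStructure _
              (D.atLevel (propagatedSelmerStructure W 3 k) d)).selmerGroup → κ.1 d = 0) := by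
  haveI : NeZero (3 ^ (k + 1)) := ⟨pow_ne_zero _ three_ne_zero⟩
  obtain ⟨hfree, -⟩ := kolyvaginSystems_freeRankOne_propagatedSelmerStructure_deep_of_towerSurj W hS24d
    hkk' htower τ hτμ hτq' inv hperf hsum hcompl hEP S hS h3S hbadS D η hP hT hD
  obtain ⟨κ, hκ, hgo, hgen⟩ := exists_basis_of_isFreeRankOneZMod _ hfree
  exact ⟨κ, hκ, hgo, hgen, fun inv' hperf' hsum' hcompl' d hd =>
    kolyvaginSystems_idealOfBasis_propagatedSelmerStructure_deep_of_towerSurj W hS24d₂ hkk' htower τ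
      hτμ hτq' inv hperf hsum hcompl hEP S hS h3S hbadS D η hP hT hD inv' hperf' hsum' hcompl' κ hκ d hd⟩

end TowerSurj

end Summit.BirchSwinnertonDyer.Rank1Residual.GaloisImage

end
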